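import Summits.ResolutionOfSingularities.ResolutionOfSingularities.Theorems.ValuativeLuAlphaPTorsorAdaptedDefs
import Summits.ResolutionOfSingularities.ResolutionOfSingularities.Theorems.ValuativeLuAlphaPTorsorAPDict
import Summits.ResolutionOfSingularities.ResolutionOfSingularities.Theorems.ValuativeLuAlphaPTorsorAPExt
import Summits.ResolutionOfSingularities.ResolutionOfSingularities.Theorems.ValuativeLuAlphaPTorsorAPUpA
import Literature.AlgebraicGeometry.Resolution.CompositeValuations
import Literature.AlgebraicGeometry.Resolution.TranscendenceDefect
import Mathlib.RingTheory.Valuation.ValuationSubring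
import Mathlib.RingTheory.Ideal.Operations
import Mathlib.RingTheory.LocalRing.MaximalIdeal.Basic
import HarnessLib

/-!
# Level calculus for adapted charts, II-B: the UP-lemma (C4, C3, lattice-archimedean levels, conclusion)

Crux `Valuative.LuAlphaPTorsor` (stmt-ResolutionOfSingularities-0641), line `pfaff-line-log-final-forms`,
lead seat c4 — `ap_flagAdaptedChart_of_residual` (registered anchor, closed form): a chart lifted
from the residue field of the rank-one top coarsening `W` is FLAG-ADAPTED. First half in
`…APUpA` (`ap_up_partA`); here the clauses (C4), (C3), `LevelArchimedean` and the conclusion.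
[folklore] (Zariski 1940; Cutkosky 2022 §4, `P_{t-i}(R) = (z_j : j > s_i)`.)
-/

set_option linter.dupNamespace false

open IsLocalRing

namespace Summit.ResolutionOfSingularities.ResolutionOfSingularities.Theorems.PfaffLine

open Literature.AlgebraicGeometry.Resolution

section Up

/-- **Adaptedness from the top coarsening and the residual chart (UP-lemma)**, registered anchor
(closed form). [folklore] -/
theorem ap_flagAdaptedChart_of_residual : ∀ {k K : Type} [Field k] [Field K] [Algebra k K] (O : ValuationSubring K) (hk : ∀ c : k, algebraMap k K c ∈ O) {n : ℕ} (R : Subalgebra k K) (hRO : R.toSubring ≤ O.toSubring) (y : Fin n → K) (hy : ∀ i, y i ∈ R) (lv : Fin n → ℕ) (top : ℕ) (hle : ∀ i, lv i ≤ top) (hT : ∃ i, lv i = top) (W : ValuationSubring K) (hOW : O ≤ W) (hWmem : ∀ z : K, z ∈ W ↔ ∃ m : Fin n → ℤ, (∀ j, top ≤ lv j → m j = 0) ∧ O.valuation z ≤ ∏ j, O.valuation (y j) ^ (m j)) (hWr1 : ∀ z w : K, W.valuation z < 1 → w ≠ 0 → ∃ N : ℕ, W.valuation z ^ N < W.valuation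 w) (hFG : R.FG) (hy0 : ∀ i, y i ≠ 0) (hWspan : Ideal.span (Set.range fun i : {i : Fin n // lv i = top} => (⟨y i.1, hy i.1⟩ : R.toSubring)) = Ideal.comap (Subring.inclusion (show R.toSubring ≤ W.toSubring from fun _ hz => hOW (hRO hz))) (maximalIdeal W)) (hWind : ∀ μ : Fin n → ℤ, (∀ j, lv j ≠ top → μ j = 0) → W.valuation (∏ j, y j ^ (μ j)) = 1 → μ = 0) (hySv : ∀ i, lv i < top → O.valuation (y i) < 1) (nS : ℕ) (e : Fin nS ≃ {i : Fin n // lv i < top}) (hres : letI := algebraOfMem k W (fun c => hOW (hk c)); ∃ (Rb : Subalgebra k (ResidueField W)) (hRb : Rb.toSubring ≤ (residueValuationSubring O W hOW).toSubring) (xb : Fin nS → ResidueField W) (hxb : ∀ j, xb j ∈ Rb), (∀ j, residue W ⟨y (e j).1, hOW (hRO (hy (e j).1))⟩ = xb j) ∧ (∀ (r : K) (hr : r ∈ R), residue W ⟨r, hOW (hRO hr)⟩ ∈ Rb) ∧ (∀ rb ∈ Rb, ∃ (r : K) (hr : r ∈ R), residue W ⟨r, hOW (hRO hr)⟩ = rb)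 ∧ FlagAdaptedChart (residueValuationSubring O W hOW) Rb hRb xb hxb (fun j => lv (e j).1)), FlagAdaptedChart O R hRO y hy lv := by
  intro k K _ _ _ O hk n R hRO y hy lv top hle hT W hOW hWmem hWr1 hFG hy0 hWspan hWind hySv nS e hres
  classical
  letI := algebraOfMem k W (fun c => hOW (hk c))
  obtain ⟨Rb, hRb, xb, hxb, hxbeq, hπR, hπsurj, hres⟩ := hres
  obtain rfl : xb = fun j => residue W ⟨y (e j).1, hOW (hRO (hy (e j).1))⟩ :=
    funext fun j => (hxbeq j).symm
  obtain ⟨⟨hbFG, hxb0, hbspan, hbind, ⟨hbC2a, hbC2b, hbC4⟩, hbC3⟩, hbLA⟩ := hres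
  dsimp only at hbC2a hbC2b hbC4 hbC3 hbLA hbind hxb0
  set Ob := residueValuationSubring O W hOW with hOb
  -- notation-free abbreviations
  have hRW : R.toSubring ≤ W.toSubring := fun z hz => hOW (hRO hz)
  have hvy0 : ∀ i, O.valuation (y i) ≠ 0 := fun i => (map_ne_zero _).mpr (hy0 i)
  have hpos : ∀ m : Fin n → ℤ, 0 < ∏ j, O.valuation (y j) ^ (m j) := fun m =>
    Finset.prod_pos fun j _ => zpow_pos (zero_lt_iff.mpr (hvy0 j)) _
  have hprodK : ∀ m : Fin n → ℤ, O.valuation (∏ j, y j ^ (m j)) = ∏ j, O.valuation (y j) ^ (m j) := by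
    intro m; rw [map_prod]; exact Finset.prod_congr rfl fun j _ => map_zpow₀ _ _ _
  have hprodK0 : ∀ m : Fin n → ℤ, (∏ j, y j ^ (m j)) ≠ 0 := fun m =>
    Finset.prod_ne_zero_iff.mpr fun j _ => zpow_ne_zero _ (hy0 j)
  -- (1) the lower parameters are units of `W`
  have hlowW : ∀ i, lv i < top → y i ∈ W ∧ (y i)⁻¹ ∈ W := ap_up_lowW O W y lv top hWmem
  have hlowu : ∀ i, lv i < top → W.valuation (y i) = 1 := fun i hi =>
    (ap_valuation_eq_one_iff_mem_inv_mem W (hy0 i)).mpr (hlowW i hi)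
  -- (2) `W`-smallness = smaller than every lower Laurent monomial
  have hWlt : ∀ z : K, W.valuation z < 1 ↔
      ∀ m : Fin n → ℤ, (∀ j, top ≤ lv j → m j = 0) → O.valuation z < ∏ j, O.valuation (y j) ^ (m j) :=
    ap_valuation_lt_one_iff_forall O W y (fun m => ∀ j, top ≤ lv j → m j = 0) hy0
      (fun _ _ => rfl) (fun m hm j hj => by rw [Pi.neg_apply, hm j hj, neg_zero]) hWmem
  -- (3) the `W`-centre of `R`
  have hWR : ∀ (z : R.toSubring), W.valuation (z : K) < 1 ↔
      z ∈ Ideal.span (Set.range fun i : {i : Fin n // lv i = top} => (⟨y i.1, hy i.1⟩ : R.toSubring)) := by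
    intro z
    rw [hWspan, Ideal.mem_comap, ValuationSubring.valuation_lt_one_iff]
    rfl
  have htopW : ∀ i, lv i = top → W.valuation (y i) < 1 := by
    intro i hi
    rw [show y i = ((⟨y i, hy i⟩ : R.toSubring) : K) from rfl, hWR]
    exact Ideal.subset_span ⟨⟨i, hi⟩, rfl⟩
  have hylt : ∀ i, O.valuation (y i) < 1 := by
    intro i
    rcases (hle i).lt_or_eq with hi | hi
    · exact hySv i hi
    · have h := (hWlt _).mp (htopW i hi) 0 (fun _ _ => rfl)
      simpa using h
  -- `W`-small ⇒ `O`-small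
  have hWO : ∀ z : K, W.valuation z < 1 → O.valuation z < 1 := by
    intro z hz
    have h := (hWlt z).mp hz 0 (fun _ _ => rfl)
    simpa using h
  have hmemW : ∀ z : K, z ∈ O → z ∈ W := fun z hz => hOW hz
  -- (4) the ring homomorphism `φ : R → κ(W)`
  let φ : R.toSubring →+* ResidueField W := (residue W).comp (Subring.inclusion hRW)
  have hφ : ∀ (z : R.toSubring), φ z = residue W ⟨(z : K), hRW z.2⟩ := fun z => rfl
  have hφ0 : ∀ (z : R.toSubring), φ z = 0 ↔ W.valuation (z : K) < 1 := by
    intro z; rw [hφ, ap_residue_eq_zero_iff]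
  -- lower parameters as elements of `R`, their residues
  have hySW : ∀ j : Fin nS, y (e j) ∈ W ∧ (y (e j))⁻¹ ∈ W := fun j => hlowW _ (e j).2
  have hySu : ∀ j : Fin nS, W.valuation (y (e j)) = 1 := fun j => hlowu _ (e j).2
  -- Laurent monomials in the lower parameters
  have hmonW : ∀ m : Fin nS → ℤ, (∏ j, y (e j) ^ (m j)) ∈ W := by
    intro m
    refine prod_mem fun j _ => ?_
    rcases Int.eq_nat_or_neg (m j) with ⟨N, h | h⟩
    · rw [h, zpow_natCast]; exact pow_mem (hySW j).1 N
    · rw [h, zpow_neg, zpow_natCast, ← inv_pow]; exact pow_mem (hySW j).2 N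
  have hmonu : ∀ m : Fin nS → ℤ, W.valuation (∏ j, y (e j) ^ (m j)) = 1 := by
    intro m; rw [map_prod]; exact Finset.prod_eq_one fun j _ => by rw [map_zpow₀, hySu, one_zpow]
  have hmonπ : ∀ m : Fin nS → ℤ, residue W ⟨∏ j, y (e j) ^ (m j), hmonW m⟩ =
      ∏ j, residue W ⟨y (e j).1, hOW (hRO (hy (e j).1))⟩ ^ (m j) :=
    fun m => ap_residue_prod_zpow W (fun j => y (e j)) (fun j => (hySW j).1) (fun j => (hySW j).2)
      (fun j => hy0 _) m (hmonW m)
  have hmonOb : ∀ m : Fin nS → ℤ, (∏ j, Ob.valuation (residue W ⟨y (e j).1, hOW (hRO (hy (e j).1))⟩) ^ (m j)) =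
      Ob.valuation (residue W ⟨∏ j, y (e j) ^ (m j), hmonW m⟩) := by
    intro m; rw [hmonπ, map_prod]
    exact Finset.prod_congr rfl fun j _ => (map_zpow₀ _ _ _).symm
  have hmonO : ∀ m : Fin nS → ℤ, O.valuation (∏ j, y (e j) ^ (m j)) = ∏ j, O.valuation (y (e j)) ^ (m j) := by
    intro m; rw [map_prod]; exact Finset.prod_congr rfl fun j _ => map_zpow₀ _ _ _
  -- extension by zero
  have hextP : ∀ (m : Fin nS → ℤ) (ℓ : ℕ), (∀ j, ℓ ≤ lv (e j) → m j = 0) → ℓ ≤ top →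
      ∀ i, ℓ ≤ lv i → Function.extend (fun j => ((e j : {i : Fin n // lv i < top}) : Fin n)) m 0 i = 0 :=
    fun m ℓ hm _ => ap_ext_vanish lv top e m ℓ hm
  -- TRANSFER of strict inequalities between lower monomials
  have htr : ∀ m m' : Fin nS → ℤ,
      (∏ j, Ob.valuation (residue W ⟨y (e j).1, hOW (hRO (hy (e j).1))⟩) ^ (m j)) <
        (∏ j, Ob.valuation (residue W ⟨y (e j).1, hOW (hRO (hy (e j).1))⟩) ^ (m' j)) ↔
      (∏ j, O.valuation (y (e j)) ^ (m j)) < ∏ j, O.valuation (y (e j)) ^ (m' j) := by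
    intro m m'
    rw [hmonOb, hmonOb, ap_resval_lt_iff O W hOW (hmonW m) (hmonW m') (hmonu m), hmonO, hmonO]
  -- transfer for a `W`-unit of `R` against a lower monomial
  have htrz : ∀ (z : K) (hzW : z ∈ W) (hzu : W.valuation z = 1) (m : Fin nS → ℤ),
      Ob.valuation (residue W ⟨z, hzW⟩) <
        (∏ j, Ob.valuation (residue W ⟨y (e j).1, hOW (hRO (hy (e j).1))⟩) ^ (m j)) ↔
      O.valuation z < ∏ j, O.valuation (y (e j)) ^ (m j) := by
    intro z hzW hzu m
    rw [hmonOb, ap_resval_lt_iff O W hOW hzW (hmonW m) hzu, hmonO]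
  -- LIFT from a residual span: if `φ z ∈ (x̄_j : q j)` then `z ∈ (y_(e j) : q j) + (y_top)`
  have hlift : ∀ (q : Fin nS → Prop) (z : R.toSubring),
      (⟨φ z, by rw [hφ]; exact hπR _ z.2⟩ : Rb.toSubring) ∈
        Ideal.span (Set.range fun j : {j : Fin nS // q j} =>
          (⟨residue W ⟨y (e j.1).1, hOW (hRO (hy (e j.1).1))⟩, hxb j.1⟩ : Rb.toSubring)) →
      z ∈ Ideal.span (Set.range fun j : {j : Fin nS // q j} => (⟨y (e j.1).1, hy (e j.1).1⟩ : R.toSubring)) ⊔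
        Ideal.span (Set.range fun i : {i : Fin n // lv i = top} => (⟨y i.1, hy i.1⟩ : R.toSubring)) := by
    intro q z hz
    obtain ⟨cb, hcb⟩ := Ideal.mem_span_range_iff_exists_fun.mp hz
    -- lift the coefficients
    have hc : ∀ j : {j : Fin nS // q j}, ∃ (c : R.toSubring), φ c = (cb j : ResidueField W) := by
      intro j
      obtain ⟨r, hr, hrr⟩ := hπsurj _ (cb j).2
      exact ⟨⟨r, hr⟩, hrr⟩
    choose c hc using hc
    set w : R.toSubring := z - ∑ j, c j * ⟨y (e j.1).1, hy (e j.1).1⟩ with hw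
    have hφw : φ w = 0 := by
      have h1 : φ z = ∑ j, φ (c j) * φ ⟨y (e j.1).1, hy (e j.1).1⟩ := by
        have := congrArg (fun t : Rb.toSubring => (t : ResidueField W)) hcb
        simp only [AddSubmonoidClass.coe_finsetSum, Subring.coe_mul] at this
        rw [← this]
        exact Finset.sum_congr rfl fun j _ => by rw [hc j]; rfl
      rw [hw, map_sub, map_sum, h1]
      simp only [map_mul, sub_self]
    have hwW : W.valuation (w : K) < 1 := (hφ0 w).mp hφw
    have hwspan := (hWR w).mp hwW
    have hz : z = (∑ j, c j * ⟨y (e j.1).1, hy (e j.1).1⟩) + w := by rw [hw]; ring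
    rw [hz]
    refine Ideal.add_mem _ (Ideal.mem_sup_left ?_) (Ideal.mem_sup_right hwspan)
    exact Ideal.sum_mem _ fun j _ => Ideal.mul_mem_left _ _ (Ideal.subset_span ⟨j, rfl⟩)
  obtain ⟨hspan, hind, hC2a, hC2b⟩ := ap_up_partA O hk R hRO y hy lv top hle hT W hOW hWmem hWr1 hFG hy0 hWspan hWind hySv nS e
    ⟨Rb, hRb, _, hxb, fun j => rfl, hπR, hπsurj, ⟨⟨hbFG, hxb0, hbspan, hbind, ⟨hbC2a, hbC2b, hbC4⟩, hbC3⟩, hbLA⟩⟩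
  -- a lower index as an element of `Fin nS`
  have hidx : ∀ i, lv i < top → ∃ j : Fin nS, ((e j : {i : Fin n // lv i < top}) : Fin n) = i :=
    fun i hi => ⟨e.symm ⟨i, hi⟩, by simp⟩
  -- restriction of a vector supported on the lower indices
  have hrestr : ∀ (m : Fin n → ℤ) (ℓ : ℕ), ℓ ≤ top → (∀ j, ℓ ≤ lv j → m j = 0) →
      Function.extend (fun j => ((e j : {i : Fin n // lv i < top}) : Fin n)) (fun j => m (e j)) 0 = m :=
    fun m ℓ hℓ hm => ap_ext_restrict lv top e m fun i hi => hm i (hℓ.trans (not_lt.mp hi))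
  have hprodr : ∀ (m : Fin n → ℤ) (ℓ : ℕ), ℓ ≤ top → (∀ j, ℓ ≤ lv j → m j = 0) →
      (∏ i, O.valuation (y i) ^ (m i)) = ∏ j, O.valuation (y (e j)) ^ (m (e j)) := by
    intro m ℓ hℓ hm
    conv_lhs => rw [← hrestr m ℓ hℓ hm]
    exact ap_prod_ext lv top e (fun i => O.valuation (y i)) _
  -- (C4)
  have hC4 : ∀ (ℓ : ℕ) (μ : Fin n → ℤ), (∀ j, lv j ≠ ℓ → μ j = 0) → μ ≠ 0 →
      (∀ m : Fin n → ℤ, (∀ j, ℓ ≤ lv j → m j = 0) →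
        (∏ j, O.valuation (y j) ^ (μ j)) < ∏ j, O.valuation (y j) ^ (m j)) ∨
      (∀ m : Fin n → ℤ, (∀ j, ℓ ≤ lv j → m j = 0) →
        (∏ j, O.valuation (y j) ^ (m j)) < ∏ j, O.valuation (y j) ^ (μ j)) := by
    intro ℓ μ hμ hμ0
    rcases lt_trichotomy ℓ top with hℓ | rfl | hℓ
    · -- lower level: transfer
      have hμS : ∀ j, ℓ + 1 ≤ lv j → μ j = 0 := fun j hj => hμ j (by omega)
      have hμr := hrestr μ (ℓ + 1) (Nat.succ_le_of_lt hℓ) hμS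
      have hμ0' : (fun j => μ (e j)) ≠ 0 := by
        intro h0; apply hμ0; rw [← hμr, h0]
        funext i; by_cases hi : lv i < top
        · obtain ⟨a, ha⟩ := hidx i hi; rw [← ha, ap_ext_apply_low]; rfl
        · exact ap_ext_apply_top lv top e _ i hi
      have h := hbC4 ℓ (fun j => μ (e j)) (fun j hj => hμ _ hj) hμ0'
      rcases h with h | h
      · left
        intro m hm
        have hmr := hprodr m ℓ hℓ.le hm
        rw [hprodr μ (ℓ + 1) (Nat.succ_le_of_lt hℓ) hμS, hmr, ← htr]
        exact h (fun j => m (e j)) (fun j hj => hm _ hj)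
      · right
        intro m hm
        have hmr := hprodr m ℓ hℓ.le hm
        rw [hprodr μ (ℓ + 1) (Nat.succ_le_of_lt hℓ) hμS, hmr, ← htr]
        exact h (fun j => m (e j)) (fun j hj => hm _ hj)
    · -- top level: `W`-independence
      have hne : W.valuation (∏ j, y j ^ (μ j)) ≠ 1 := fun h1 => hμ0 (hWind μ hμ h1)
      rcases lt_or_gt_of_ne hne with hlt | hgt
      · left
        intro m hm
        rw [← hprodK]; exact (hWlt _).mp hlt m hm
      · right
        intro m hm
        have hlt : W.valuation (∏ j, y j ^ ((-μ) j)) < 1 := by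
          have : (∏ j, y j ^ ((-μ) j)) = (∏ j, y j ^ (μ j))⁻¹ := by
            rw [← Finset.prod_inv_distrib]
            exact Finset.prod_congr rfl fun j _ => by rw [Pi.neg_apply, zpow_neg]
          rw [this, map_inv₀, inv_lt_one₀ (zero_lt_one.trans hgt)]; exact hgt
        have h := (hWlt _).mp hlt (-m) (fun j hj => by rw [Pi.neg_apply, hm j hj, neg_zero])
        rw [hprodK] at h
        have e1 : (∏ j, O.valuation (y j) ^ ((-μ) j)) = (∏ j, O.valuation (y j) ^ (μ j))⁻¹ := by
          rw [← Finset.prod_inv_distrib]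
          exact Finset.prod_congr rfl fun j _ => by rw [Pi.neg_apply, zpow_neg]
        have e2 : (∏ j, O.valuation (y j) ^ ((-m) j)) = (∏ j, O.valuation (y j) ^ (m j))⁻¹ := by
          rw [← Finset.prod_inv_distrib]
          exact Finset.prod_congr rfl fun j _ => by rw [Pi.neg_apply, zpow_neg]
        rw [e1, e2, inv_lt_inv₀ (hpos μ) (hpos m)] at h
        exact h
    · -- above the top: no such index
      exfalso; apply hμ0; funext j; exact hμ j (by have := hle j; omega)
  -- (C3)
  have hC3 : ∀ (ℓ : ℕ) (z : R.toSubring),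
      z ∈ Ideal.span (Set.range fun i : {i : Fin n // ℓ ≤ lv i} => (⟨y i.1, hy i.1⟩ : R.toSubring)) ↔
        ∀ m : Fin n → ℤ, (∀ j, ℓ ≤ lv j → m j = 0) →
          O.valuation (z : K) < ∏ j, O.valuation (y j) ^ (m j) := by
    intro ℓ z
    rcases le_or_gt ℓ top with hℓ | hℓ
    · constructor
      · -- elements of the ideal are small
        intro hz m hm
        obtain ⟨c, hc⟩ := Ideal.mem_span_range_iff_exists_fun.mp hz
        have hzK : (z : K) = ∑ i : {i : Fin n // ℓ ≤ lv i}, (c i : K) * y i.1 := by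
          have := congrArg (fun t : R.toSubring => (t : K)) hc
          simp only [AddSubmonoidClass.coe_finsetSum, Subring.coe_mul] at this
          exact this.symm
        rw [hzK]
        refine Valuation.map_sum_lt _ (ne_of_gt (hpos m)) fun i _ => ?_
        rw [map_mul]
        refine lt_of_le_of_lt (mul_le_of_le_one_left' ((O.valuation_le_one_iff _).mpr (hRO (c i).2))) ?_
        -- `v(y_i) < v(y^m)` for `ℓ ≤ lv i` and `m` supported below `ℓ`
        by_cases hm0 : m = 0
        · rw [hm0]; simpa using hylt i.1
        · -- the highest level in the support of `m`
          have hsup : (Finset.univ.filter fun j => m j ≠ 0).Nonempty := by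
            by_contra h
            rw [Finset.not_nonempty_iff_eq_empty, Finset.filter_eq_empty_iff] at h
            exact hm0 (funext fun j => by simpa using h (Finset.mem_univ j))
          obtain ⟨j₀, hj₀, hmax⟩ := Finset.exists_max_image _ lv hsup
          have hj₀m : m j₀ ≠ 0 := (Finset.mem_filter.mp hj₀).2
          have hj₀ℓ : lv j₀ < ℓ := by
            by_contra h; exact hj₀m (hm j₀ (not_lt.mp h))
          exact hC2a j₀ i.1 (lt_of_lt_of_le hj₀ℓ i.2) m fun j hj => by
            by_contra h; exact absurd (hmax j (Finset.mem_filter.mpr ⟨Finset.mem_univ _, h⟩)) (not_le.mpr hj)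
      · intro h
        by_cases hzW : W.valuation (z : K) < 1
        · exact Ideal.span_mono (by rintro _ ⟨i, rfl⟩; exact ⟨⟨i.1, hℓ.trans_eq i.2.symm⟩, rfl⟩) ((hWR z).mp hzW)
        · have hzu : W.valuation (z : K) = 1 :=
            le_antisymm ((W.valuation_le_one_iff _).mpr (hRW z.2)) (not_lt.mp hzW)
          -- transfer the smallness to the residual chart
          have hres : ∀ m : Fin nS → ℤ, (∀ j, ℓ ≤ lv (e j) → m j = 0) →
              Ob.valuation (residue W ⟨(z : K), hRW z.2⟩) <
                ∏ j, Ob.valuation (residue W ⟨y (e j).1, hOW (hRO (hy (e j).1))⟩) ^ (m j) := by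
            intro m hm
            rw [htrz _ (hRW z.2) hzu]
            have h1 := h (Function.extend (fun j => ((e j : {i : Fin n // lv i < top}) : Fin n)) m 0)
              (hextP m ℓ hm hℓ)
            rwa [ap_prod_ext lv top e (fun i => O.valuation (y i))] at h1
          have hmem := (hbC3 ℓ ⟨φ z, by rw [hφ]; exact hπR _ z.2⟩).mpr hres
          have h2 := hlift (fun j => ℓ ≤ lv (e j)) z hmem
          have hle2 : Ideal.span (Set.range fun j : {j : Fin nS // ℓ ≤ lv (e j)} =>
                (⟨y (e j.1).1, hy (e j.1).1⟩ : R.toSubring)) ⊔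
              Ideal.span (Set.range fun i : {i : Fin n // lv i = top} => (⟨y i.1, hy i.1⟩ : R.toSubring)) ≤
              Ideal.span (Set.range fun i : {i : Fin n // ℓ ≤ lv i} => (⟨y i.1, hy i.1⟩ : R.toSubring)) :=
            sup_le (Ideal.span_mono (by rintro _ ⟨j, rfl⟩; exact ⟨⟨(e j.1).1, j.2⟩, rfl⟩))
              (Ideal.span_mono (by rintro _ ⟨i, rfl⟩; exact ⟨⟨i.1, hℓ.trans_eq i.2.symm⟩, rfl⟩))
          exact hle2 h2
    · -- above the top: both sides say `z = 0`
      have hempty : IsEmpty {i : Fin n // ℓ ≤ lv i} := ⟨fun i => absurd (i.2.trans (hle i.1)) (not_le.mpr hℓ)⟩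
      have hbot : Ideal.span (Set.range fun i : {i : Fin n // ℓ ≤ lv i} => (⟨y i.1, hy i.1⟩ : R.toSubring)) = ⊥ := by
        rw [Set.range_eq_empty, Ideal.span_empty]
      rw [hbot, Ideal.mem_bot]
      constructor
      · rintro rfl m -
        simp only [ZeroMemClass.coe_zero, map_zero]
        exact hpos m
      · intro h
        by_contra hz0
        have hz0' : (z : K) ≠ 0 := fun h0 => hz0 (Subtype.ext h0)
        obtain ⟨i₀, hi₀⟩ := hT
        obtain ⟨N, hN⟩ := hWr1 (y i₀) z (htopW i₀ hi₀) hz0'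
        have hlt : W.valuation (y i₀ ^ N / z) < 1 := by
          rw [map_div₀, map_pow, div_lt_one₀ ((Valuation.pos_iff _).mpr hz0')]; exact hN
        have h1 := hWO _ hlt
        rw [map_div₀, map_pow, div_lt_one₀ ((Valuation.pos_iff _).mpr hz0')] at h1
        have h2 := h (Pi.single i₀ (N : ℤ)) (fun j hj => by have := hle j; omega)
        rw [Finset.prod_eq_single i₀ (fun j _ hj => by simp [hj]) (by simp)] at h2
        simp only [Pi.single_eq_same, zpow_natCast] at h2
        exact lt_irrefl _ (h1.trans h2)
  -- LevelArchimedean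
  have hLA : LevelArchimedean (fun i => O.valuation (y i)) lv := by
    intro ℓ μ μ' hμ hμ' hsmall
    rcases lt_trichotomy ℓ top with hℓ | rfl | hℓ
    · -- lower level: transfer
      have hμS : ∀ j, ℓ + 1 ≤ lv j → μ j = 0 := fun j hj => hμ j (by omega)
      have hμ'S : ∀ j, ℓ + 1 ≤ lv j → μ' j = 0 := fun j hj => hμ' j (by omega)
      have hsmall' : ∀ m : Fin nS → ℤ, (∀ j, ℓ ≤ lv (e j) → m j = 0) →
          (∏ j, Ob.valuation (residue W ⟨y (e j).1, hOW (hRO (hy (e j).1))⟩) ^ (μ (e j))) <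
            ∏ j, Ob.valuation (residue W ⟨y (e j).1, hOW (hRO (hy (e j).1))⟩) ^ (m j) := by
        intro m hm
        rw [htr, ← hprodr μ (ℓ + 1) (Nat.succ_le_of_lt hℓ) hμS]
        have h1 := hsmall (Function.extend (fun j => ((e j : {i : Fin n // lv i < top}) : Fin n)) m 0)
          (hextP m ℓ hm hℓ.le)
        rwa [ap_prod_ext lv top e (fun i => O.valuation (y i))] at h1
      obtain ⟨N, hN⟩ := hbLA ℓ (fun j => μ (e j)) (fun j => μ' (e j)) (fun j hj => hμ _ hj)
        (fun j hj => hμ' _ hj) hsmall'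
      refine ⟨N, ?_⟩
      -- transfer back: `(∏ v̄^μ)^N = v̄-value of the `W`-unit `(y^μ)^N`
      have hpow : (∏ j, Ob.valuation (residue W ⟨y (e j).1, hOW (hRO (hy (e j).1))⟩) ^ (μ (e j))) ^ N =
          ∏ j, Ob.valuation (residue W ⟨y (e j).1, hOW (hRO (hy (e j).1))⟩) ^ ((N : ℤ) * μ (e j)) := by
        rw [← Finset.prod_pow]
        exact Finset.prod_congr rfl fun j _ => by rw [← zpow_natCast, ← zpow_mul, mul_comm]
      rw [hpow, htr] at hN
      rw [hprodr μ (ℓ + 1) (Nat.succ_le_of_lt hℓ) hμS, hprodr μ' (ℓ + 1) (Nat.succ_le_of_lt hℓ) hμ'S]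
      refine lt_of_eq_of_lt ?_ hN
      rw [← Finset.prod_pow]
      exact Finset.prod_congr rfl fun j _ => by rw [← zpow_natCast, ← zpow_mul, mul_comm]
    · -- top level: rank one of `W`
      have hμW : W.valuation (∏ j, y j ^ (μ j)) < 1 := by
        rw [hWlt]; intro m hm; rw [hprodK]; exact hsmall m hm
      obtain ⟨N, hN⟩ := hWr1 _ (∏ j, y j ^ (μ' j)) hμW (hprodK0 μ')
      refine ⟨N, ?_⟩
      have hlt : W.valuation ((∏ j, y j ^ (μ j)) ^ N / ∏ j, y j ^ (μ' j)) < 1 := by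
        rw [map_div₀, map_pow, div_lt_one₀ ((Valuation.pos_iff _).mpr (hprodK0 μ'))]; exact hN
      have h := hWO _ hlt
      rwa [map_div₀, map_pow, div_lt_one₀ ((Valuation.pos_iff _).mpr (hprodK0 μ')), hprodK, hprodK] at h
    · -- above the top: `μ = 0` and the hypothesis is contradictory
      exfalso
      have hμ0 : μ = 0 := by funext j; exact hμ j (by have := hle j; omega)
      have h := hsmall 0 (fun _ _ => rfl)
      rw [hμ0] at h
      exact lt_irrefl _ h
  exact ⟨⟨hFG, hy0, hspan, hind, ⟨hC2a, hC2b, hC4⟩, hC3⟩, hLA⟩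

end Up

end Summit.ResolutionOfSingularities.ResolutionOfSingularities.Theorems.PfaffLine
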